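import Literature.Computability.AlgebraicComplexity.KV20LinearCircuitEquationsProofs
import Mathlib.Algebra.MvPolynomial.Funext
import HarnessLib

/-!
# Kumar–Volk 2020/2022, §4.1: a denominator-free (integer) universal map for small linear circuits

Topic `Literature/Computability/AlgebraicComplexity`; theorem-only companion of
`KV20LinearCircuitEquationsProofs.lean` (M. Kumar, B. L. Volk, ACM TOCT 14(2) (2022) art. 6 =
arXiv:2003.12938 [KumarVolk2022], §4.1 / Lemma 4.1 = arXiv Lemma 8: the universal map
`U(x, y) : F^{2s} → F^{n²}` whose image contains every `n × n` matrix with a linear circuit of size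
`≤ s`). The tree's `KumarVolk2020.universalMap a` labels the edge slots of the universal circuit by
the Shpilka–Volkovich coordinates `SV(x, y)_e = Σ_j u_e(y_j) x_j` with the Lagrange INDICATORS
`u_e(z) = ∏_{e' ≠ e} (z − α_{e'}) / (α_e − α_{e'})` — polynomials over the FIELD `F`, with
denominators. For the Boolean side of the source's Cor. 1.3 (§6: "`C ∘ U ≡ 0`" is submitted to
polynomial identity testing for INTEGER circuits, the tree's `PITLanguage`) one needs the same map
with integer coefficients. This file replaces the indicators by the Lagrange NUMERATORS
`ũ_e(z) = ∏_{e' ≠ e} (z − α_{e'})` with the integer nodes `α_e =` (the explicit index of the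
slot `e`, `slotEquiv`: block by block, row-major — computable by a string machine), which
changes nothing in the proof of Lemma 4.1 over a field of characteristic `0`: at `y_j = α_{e_j}` the
`e_j`-th coordinate of `S̃V(x, α)` is `N_{e_j} · x_j` with the nonzero integer
`N_e = ∏_{e' ≠ e} (α_e − α_{e'})`, so the labelling `β` is hit with `x_j = β_{e_j} / N_{e_j}`.

## Main statements (all proved; no facts, no new notions beyond the three polynomial maps)

* `lagrangeNumerator`, `svMapInt`, `slotEquiv`/`slotNode` (explicit slot indices),
  `universalMapInt n s : Fin n × Fin n → ℤ[x_s ⊕ y_s]`;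
* `totalDegree_universalMapInt_le` — degree `≤ s'(s+1)`, `s' = sn + s² + n(n+s)` (as for `universalMap`);
* `smallLinCircuitSet_subset_polyMapImage_universalMapInt` — for every field `K` of characteristic
  `0`, every `n × n` matrix over `K` with a linear circuit of size `≤ s` is in the image of the
  integer universal map read in `K` (Lemma 4.1, integer form);
* `exists_int_equation_universalMapInt` — for `n ≥ 1` and `200 s ≤ n²` there is a nonzero INTEGER
  polynomial `Q` of degree `≤ n³` with `Q ∘ Ũ = 0` identically (`bind₁ (universalMapInt n s) Q = 0`):
  Theorem 1.2's dimension count (`exists_isEquationFor_polyMapImage`, `thm_1_2_count`) over `ℚ`,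
  then denominators cleared;
* `not_mem_smallLinCircuitSet_of_eval_ne_zero` — soundness of the certificate used in the proof of
  Cor. 1.3: if `Q ∘ Ũ = 0` and `Q(M) ≠ 0` for an integer matrix `M`, then `M` (read in any field of
  characteristic `0`) has no linear circuit of size `≤ s`.

Honest framing (val-lit, row X5): plumbing towards `kumarVolk2020_cor_1_3` (brick (Uℤ) of
HOME/np/MEMO-x5g6-KV20-cor13-roster.md); nothing here bears on `VP ≠ VNP`, which is NOT proved.

## References

* [KumarVolk2022] M. Kumar, B. L. Volk, ACM TOCT 14(2) (2022) art. 6 = arXiv:2003.12938, §4.1,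
  Lemma 4.1 (arXiv Lemma 8) and its proof; Lemma 3.1 (the map `SV`); §6 (proof of Cor. 1.3).
* [SV15] A. Shpilka, I. Volkovich, *Read-once polynomial identity testing*, Comput. Complexity 24
  (2015) (the generator `SV`).
-/

noncomputable section

open MvPolynomial

namespace Literature.Computability.AlgebraicComplexity

namespace KumarVolk2020

/-! ### Lagrange numerators and the integer Shpilka–Volkovich map -/

section SVInt

variable {ι : Type*} [Fintype ι] [DecidableEq ι]

/-- The Lagrange NUMERATOR `ũ_i(z) = ∏_{i' ≠ i} (z − α_{i'})` of the node `α_i` among integer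
nodes `α : ι → ℤ`, in the variable `z = X v` (the tree's `lagrangeIndicator` without its
denominator). [cite: KumarVolk2022, Lemma 3.1 (proof)] -/
def lagrangeNumerator {τ : Type*} (a : ι → ℤ) (i : ι) (v : τ) : MvPolynomial τ ℤ :=
  ∏ i' ∈ Finset.univ.erase i, (X v - C (a i'))

/-- The node constant `N_i = ∏_{i' ≠ i} (α_i − α_{i'})` (the cleared denominator).
[cite: KumarVolk2022, Lemma 3.1 (proof)] -/
def lagrangeDenom (a : ι → ℤ) (i : ι) : ℤ :=
  ∏ i' ∈ Finset.univ.erase i, (a i - a i')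

/-- For distinct nodes the node constant is nonzero. [cite: KumarVolk2022, Lemma 3.1 (proof)] -/
theorem lagrangeDenom_ne_zero (a : ι ↪ ℤ) (i : ι) : lagrangeDenom a i ≠ 0 := by
  unfold lagrangeDenom
  refine Finset.prod_ne_zero_iff.2 fun i' hi' => ?_
  exact sub_ne_zero.2 fun h => (Finset.mem_erase.1 hi').1 (a.injective h).symm

omit [Fintype ι] [DecidableEq ι] in
/-- Each factor `z − b` has degree `≤ 1`. [folklore] -/
private theorem totalDegree_X_sub_C_le {τ : Type*} (v : τ) (b : ℤ) :
    (X v - C b : MvPolynomial τ ℤ).totalDegree ≤ 1 := by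
  refine (totalDegree_sub _ _).trans (max_le (totalDegree_X v).le ?_)
  rw [totalDegree_C]; exact Nat.zero_le _

/-- `deg ũ_i ≤ |ι| − 1`. [cite: KumarVolk2022, Lemma 3.1 (proof)] -/
theorem totalDegree_lagrangeNumerator_le {τ : Type*} (a : ι → ℤ) (i : ι) (v : τ) :
    (lagrangeNumerator a i v).totalDegree ≤ Fintype.card ι - 1 := by
  unfold lagrangeNumerator
  refine (totalDegree_finsetProd _ _).trans ?_
  calc ∑ i' ∈ Finset.univ.erase i, (X v - C (a i') : MvPolynomial τ ℤ).totalDegree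
      ≤ ∑ _i' ∈ Finset.univ.erase i, 1 := Finset.sum_le_sum fun i' _ => totalDegree_X_sub_C_le _ _
    _ = Fintype.card ι - 1 := by
        rw [Finset.sum_const, smul_eq_mul, mul_one, Finset.card_erase_of_mem (Finset.mem_univ _),
          Finset.card_univ]

/-- **`ũ_i(α_j) = [i = j] · N_i`** over any commutative ring `K`: at an assignment sending `v` to
the node `α_j`, the numerator `ũ_i` (read in `K`) evaluates to `N_i` if `i = j` and to `0`
otherwise. [cite: KumarVolk2022, Lemma 3.1 (proof)] -/
theorem eval_map_lagrangeNumerator {K : Type*} [CommRing K] {τ : Type*} (a : ι → ℤ) (i j : ι)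
    (v : τ) (g : τ → K) (hg : g v = a j) :
    eval g (map (Int.castRingHom K) (lagrangeNumerator a i v)) =
      if i = j then (lagrangeDenom a i : K) else 0 := by
  unfold lagrangeNumerator lagrangeDenom
  rw [map_prod, eval_prod]
  simp only [map_sub, map_X, map_C, eval_X, eval_C, Int.coe_castRingHom, hg]
  split_ifs with hij
  · subst hij
    rw [Int.cast_prod]
    refine Finset.prod_congr rfl fun i' _ => ?_
    push_cast; ring
  · refine Finset.prod_eq_zero (Finset.mem_erase.2 ⟨fun h => hij h.symm, Finset.mem_univ j⟩) ?_
    rw [sub_self]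

/-- **The integer map `S̃V_{ι,k}`**: `P_i(x, y) = ∑_{j < k} ũ_i(y_j) · x_j` (variables `x = inl`,
`y = inr`). [cite: KumarVolk2022, Lemma 3.1 (proof)] -/
def svMapInt (a : ι → ℤ) (k : ℕ) (i : ι) : MvPolynomial (Fin k ⊕ Fin k) ℤ :=
  ∑ j : Fin k, lagrangeNumerator a i (Sum.inr j) * X (Sum.inl j)

/-- `deg P_i ≤ (|ι| − 1) + 1 ≤ |ι|`. [cite: KumarVolk2022, Lemma 3.1] -/
theorem totalDegree_svMapInt_le (a : ι → ℤ) (k : ℕ) (i : ι) :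
    (svMapInt a k i).totalDegree ≤ Fintype.card ι := by
  have hcard : 1 ≤ Fintype.card ι := Fintype.card_pos_iff.2 ⟨i⟩
  unfold svMapInt
  refine totalDegree_finsetSum_le fun j _ => ?_
  calc (lagrangeNumerator a i (Sum.inr j) * X (Sum.inl j) : MvPolynomial (Fin k ⊕ Fin k) ℤ).totalDegree
      ≤ (lagrangeNumerator a i (Sum.inr j) : MvPolynomial (Fin k ⊕ Fin k) ℤ).totalDegree +
          (X (Sum.inl j) : MvPolynomial (Fin k ⊕ Fin k) ℤ).totalDegree := totalDegree_mul _ _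
    _ ≤ (Fintype.card ι - 1) + 1 :=
        Nat.add_le_add (totalDegree_lagrangeNumerator_le a i _) (totalDegree_X _).le
    _ = Fintype.card ι := Nat.sub_add_cancel hcard

/-- Evaluation of `S̃V` (read in `K`) at `y_j = α_{T j}`:
`P_i(x, α_T) = ∑_j [i = T j] · N_i · x_j`. [cite: KumarVolk2022, Lemma 3.1 (proof)] -/
theorem eval_map_svMapInt {K : Type*} [CommRing K] (a : ι → ℤ) {k : ℕ} (T : Fin k → ι)
    (x : Fin k → K) (i : ι) :
    eval (Sum.elim x fun j => (a (T j) : K)) (map (Int.castRingHom K) (svMapInt a k i)) =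
      ∑ j, if i = T j then (lagrangeDenom a i : K) * x j else 0 := by
  unfold svMapInt
  rw [map_sum, eval_sum]
  refine Finset.sum_congr rfl fun j _ => ?_
  rw [map_mul, map_X, eval_mul, eval_X,
    eval_map_lagrangeNumerator a i (T j) (Sum.inr j) _ (by simp)]
  simp

/-- Off the selected coordinates `S̃V(x, α_T)` vanishes. [cite: KumarVolk2022, Lemma 3.1] -/
theorem eval_map_svMapInt_of_not_mem_range {K : Type*} [CommRing K] (a : ι → ℤ) {k : ℕ}
    (T : Fin k → ι) (x : Fin k → K) {i : ι} (hi : i ∉ Set.range T) :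
    eval (Sum.elim x fun j => (a (T j) : K)) (map (Int.castRingHom K) (svMapInt a k i)) = 0 := by
  rw [eval_map_svMapInt]
  refine Finset.sum_eq_zero fun j _ => ?_
  rw [if_neg]
  exact fun h => hi ⟨j, h.symm⟩

/-- On the selected coordinate `i_j = T j` (`T` injective) `S̃V(x, α_T)` equals `N_{T j} · x_j`.
[cite: KumarVolk2022, Lemma 3.1] -/
theorem eval_map_svMapInt_apply {K : Type*} [CommRing K] (a : ι → ℤ) {k : ℕ} (T : Fin k ↪ ι)
    (x : Fin k → K) (j : Fin k) :
    eval (Sum.elim x fun j => (a (T j) : K)) (map (Int.castRingHom K) (svMapInt a k (T j))) =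
      (lagrangeDenom a (T j) : K) * x j := by
  rw [eval_map_svMapInt]
  have : ∀ j', (if T j = T j' then (lagrangeDenom a (T j) : K) * x j' else 0) =
      if j = j' then (lagrangeDenom a (T j) : K) * x j' else 0 := fun j' => by
    simp only [T.injective.eq_iff]
  simp_rw [this]
  rw [Finset.sum_ite_eq]
  simp

/-- **The Shpilka–Volkovich step over a field of characteristic `0`, integer form**: every
labelling `β : ι → K` with at most `k` nonzero labels is `S̃V(x, α_T)` read in `K`, for distinct
integer nodes `α` (take `T ⊇ supp β` of size `k`, `y = α_T`, `x_j = β_{T j} / N_{T j}`).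
[cite: KumarVolk2022, Lemma 4.1 (proof)] -/
theorem exists_eval_map_svMapInt_eq {K : Type*} [Field K] [CharZero K] (a : ι ↪ ℤ) {k : ℕ}
    (hk : k ≤ Fintype.card ι) (β : ι → K) (hβ : Nat.card {e // β e ≠ 0} ≤ k) :
    ∃ γ : Fin k ⊕ Fin k → K, ∀ e, eval γ (map (Int.castRingHom K) (svMapInt a k e)) = β e := by
  classical
  set supp : Finset ι := Finset.univ.filter fun e => β e ≠ 0 with hsupp
  have hcard : supp.card ≤ k := by
    have h : Nat.card {e // β e ≠ 0} = supp.card :=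
      Nat.subtype_card supp fun e => by simp [hsupp]
    rw [← h]
    exact hβ
  have hkU : k ≤ (Finset.univ : Finset ι).card := by rwa [Finset.card_univ]
  obtain ⟨T, hT, hTcard⟩ := Finset.exists_superset_card_eq hcard hkU
  let π : Fin k → ι := fun t => (T.equivFin.symm (Fin.cast hTcard.symm t) : ι)
  have hπinj : Function.Injective π := fun t t' h => by
    have := Subtype.ext h
    simpa [π] using this
  have hπT : ∀ e, β e ≠ 0 → e ∈ Set.range π := fun e he =>
    ⟨Fin.cast hTcard (T.equivFin ⟨e, hT (by simp [hsupp, he])⟩), by simp [π]⟩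
  let πe : Fin k ↪ ι := ⟨π, hπinj⟩
  refine ⟨Sum.elim (fun t => β (π t) / (lagrangeDenom a (π t) : K)) (fun t => (a (π t) : K)),
    fun e => ?_⟩
  by_cases he : e ∈ Set.range π
  · obtain ⟨t, rfl⟩ := he
    have h := eval_map_svMapInt_apply a πe (fun t => β (π t) / (lagrangeDenom a (π t) : K)) t
    have hN : (lagrangeDenom a (π t) : K) ≠ 0 := Int.cast_ne_zero.2 (lagrangeDenom_ne_zero a _)
    exact h.trans (mul_div_cancel₀ _ hN)
  · rw [eval_map_svMapInt_of_not_mem_range a π _ he]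
    by_contra hne
    exact he (hπT e (Ne.symm hne))

end SVInt

/-! ### The integer universal map -/

section UniversalMapInt

variable (n s : ℕ)

/-- **Explicit enumeration of the edge slots** by `0, …, s'−1`, `s' = sn + s² + n(n+s)`, block by
block (`finSumFinEquiv`) and row-major inside each block (`finProdFinEquiv`, `(t, i) ↦ i + n·t`):
`X_i → t ↦ i + n t`, `t' → t ↦ sn + (t' + s t)`, `X_i → out_j ↦ sn + s² + (i + (n+s) j)`,
`t → out_j ↦ sn + s² + ((n + t) + (n+s) j)` (`val_slotEquiv_*`). An explicit arithmetic index
(rather than `Fintype.equivFin`) so that a string machine can compute the node of a slot from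
loop counters (the `FP` writer of the universal circuit, val-lit roster KV20 Cor 1.3 (W)).
[cite: KumarVolk2022, §4.1] -/
def slotEquiv : USlot n s ≃ Fin (s * n + (s * s + n * (n + s))) :=
  (Equiv.sumCongr finProdFinEquiv
    ((Equiv.sumCongr finProdFinEquiv
      ((Equiv.prodCongr (Equiv.refl (Fin n)) finSumFinEquiv).trans finProdFinEquiv)).trans
      finSumFinEquiv)).trans finSumFinEquiv

/-- Index of the slot `X_i → t`: `i + n·t`. [cite: KumarVolk2022, §4.1] -/
@[simp] theorem val_slotEquiv_in (t : Fin s) (i : Fin n) :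
    (slotEquiv n s (Sum.inl (t, i)) : ℕ) = i + n * t := by
  simp [slotEquiv, finProdFinEquiv]

/-- Index of the slot `t' → t`: `sn + (t' + s·t)`. [cite: KumarVolk2022, §4.1] -/
@[simp] theorem val_slotEquiv_gate (t t' : Fin s) :
    (slotEquiv n s (Sum.inr (Sum.inl (t, t'))) : ℕ) = s * n + (t' + s * t) := by
  simp [slotEquiv, finProdFinEquiv]

/-- Index of the slot `X_i → out_j`: `sn + s² + (i + (n+s)·j)`. [cite: KumarVolk2022, §4.1] -/
@[simp] theorem val_slotEquiv_outIn (j i : Fin n) :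
    (slotEquiv n s (Sum.inr (Sum.inr (j, Sum.inl i))) : ℕ) = s * n + (s * s + (i + (n + s) * j)) := by
  simp [slotEquiv, finProdFinEquiv]

/-- Index of the slot `t → out_j`: `sn + s² + ((n + t) + (n+s)·j)`. [cite: KumarVolk2022, §4.1] -/
@[simp] theorem val_slotEquiv_outGate (j : Fin n) (t : Fin s) :
    (slotEquiv n s (Sum.inr (Sum.inr (j, Sum.inr t))) : ℕ) =
      s * n + (s * s + ((n + t) + (n + s) * j)) := by
  simp [slotEquiv, finProdFinEquiv]

/-- **The integer nodes of the edge slots**: slot `e ↦` its explicit index `slotEquiv e`, read in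
`ℤ` (distinct nodes, as Lemma 3.1 requires). [cite: KumarVolk2022, §4.1] -/
def slotNode : USlot n s ↪ ℤ :=
  (slotEquiv n s).toEmbedding.trans (Fin.valEmbedding.trans Nat.castEmbedding)

/-- The node of a slot is its index. [cite: KumarVolk2022, §4.1] -/
@[simp] theorem slotNode_apply (e : USlot n s) : slotNode n s e = ((slotEquiv n s e : ℕ) : ℤ) := rfl

/-- **Index form of the Lagrange numerators**: with the nodes `slotNode`, the numerator of the
slot `e` is the product over the INDICES `a < s'`, `a ≠ slotEquiv e`, of `z − a` (the shape in
which a string machine writes the gate: one product gate over a range of earlier gates).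
[cite: KumarVolk2022, Lemma 3.1 (proof)] -/
theorem lagrangeNumerator_slotNode {τ : Type*} (e : USlot n s) (v : τ) :
    lagrangeNumerator (slotNode n s) e v =
      ∏ a ∈ (Finset.range (s * n + (s * s + n * (n + s)))).erase (slotEquiv n s e : ℕ),
        (X v - C (a : ℤ)) := by
  classical
  unfold lagrangeNumerator
  -- reindex along `slotEquiv`, then along `Fin.val`
  have h1 : ∏ i' ∈ Finset.univ.erase e, (X v - C (slotNode n s i') : MvPolynomial τ ℤ) =
      ∏ k ∈ Finset.univ.erase (slotEquiv n s e), (X v - C ((k : ℕ) : ℤ)) := by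
    refine Finset.prod_equiv (slotEquiv n s) (fun i' => ?_) (fun i' _ => by rw [slotNode_apply])
    simp only [Finset.mem_erase, Finset.mem_univ, and_true, ne_eq, EmbeddingLike.apply_eq_iff_eq]
  rw [h1]
  have h2 : (Finset.range (s * n + (s * s + n * (n + s)))).erase (slotEquiv n s e : ℕ) =
      (Finset.univ.erase (slotEquiv n s e)).map Fin.valEmbedding := by
    rw [Finset.map_erase, Fin.map_valEmbedding_univ, Nat.Iio_eq_range]
    rfl
  rw [h2, Finset.prod_map]
  rfl

/-- **Index form of the integer Shpilka–Volkovich coordinates** of the universal map's slots.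
[cite: KumarVolk2022, Lemma 3.1 (proof)] -/
theorem svMapInt_slotNode (e : USlot n s) :
    svMapInt (slotNode n s) s e =
      ∑ j : Fin s, (∏ a ∈ (Finset.range (s * n + (s * s + n * (n + s)))).erase (slotEquiv n s e : ℕ),
        (X (Sum.inr j) - C (a : ℤ))) * X (Sum.inl j) := by
  unfold svMapInt
  simp only [lagrangeNumerator_slotNode]

/-- **The integer universal map `Ũ(x, y)` for size-`s` linear circuits**: the matrix computed by
the universal circuit whose edge slots are labelled by the coordinates of the integer
Shpilka–Volkovich map `S̃V_{s',s}(x, y)` (`svMapInt`, nodes `slotNode`), entry `p = (j, i)`;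
variables `x = inl`, `y = inr` of `Fin s ⊕ Fin s`. [cite: KumarVolk2022, §4.1] -/
def universalMapInt (p : Fin n × Fin n) : MvPolynomial (Fin s ⊕ Fin s) ℤ :=
  ucOut (fun e => svMapInt (slotNode n s) s e) p.1 p.2

/-- **"The degree of `Ũ` is at most `s'·(s+1)`"**, `s' = sn + s² + n(n+s)`.
[cite: KumarVolk2022, Lemma 4.1] -/
theorem totalDegree_universalMapInt_le (p : Fin n × Fin n) :
    (universalMapInt n s p).totalDegree ≤ (s * n + (s * s + n * (n + s))) * (s + 1) := by
  classical
  rw [← card_uSlot]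
  exact totalDegree_ucOut_le _ (fun e => totalDegree_svMapInt_le (slotNode n s) s e) p.1 p.2

variable {n s}

/-- The integer universal map read in a commutative ring `K`, evaluated at `γ`, is the matrix
computed by the universal circuit under the labelling `e ↦ S̃V_e(γ)`. [cite: KumarVolk2022, §4.1] -/
theorem eval_map_universalMapInt {K : Type*} [CommRing K] (γ : Fin s ⊕ Fin s → K)
    (p : Fin n × Fin n) :
    eval γ (map (Int.castRingHom K) (universalMapInt n s p)) =
      ucOut (fun e => eval γ (map (Int.castRingHom K) (svMapInt (slotNode n s) s e))) p.1 p.2 := by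
  unfold universalMapInt
  rw [map_ucOut (MvPolynomial.map (Int.castRingHom K)), map_ucOut (eval γ)]

/-- **Image of the integer universal map** (over a field `K` of characteristic `0`): the matrix
computed by the universal circuit under any labelling with at most `s` nonzero labels is in the
image of `Ũ` read in `K`. [cite: KumarVolk2022, Lemma 4.1 (proof)] -/
theorem ucOut_mem_polyMapImage_universalMapInt {K : Type*} [Field K] [CharZero K]
    (β : USlot n s → K) (hβ : Nat.card {e // β e ≠ 0} ≤ s) :
    (fun p : Fin n × Fin n => ucOut β p.1 p.2) ∈
      polyMapImage (fun p => map (Int.castRingHom K) (universalMapInt n s p)) := by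
  classical
  have hsU : s ≤ Fintype.card (USlot n s) := by
    rw [card_uSlot]
    exact (Nat.le_mul_self s).trans (Nat.le_add_right _ _ |>.trans (Nat.le_add_left _ _))
  obtain ⟨γ, hγ⟩ := exists_eval_map_svMapInt_eq (slotNode n s) hsU β hβ
  refine ⟨γ, funext fun p => ?_⟩
  show eval γ (map (Int.castRingHom K) (universalMapInt n s p)) = ucOut β p.1 p.2
  rw [eval_map_universalMapInt]
  simp only [hγ]

/-- **Lemma 4.1 for the integer universal map**: over every field `K` of characteristic `0`,
`smallLinCircuitSet K n s ⊆ Im Ũ` (circuit side = the tree's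
`exists_labels_of_mem_smallLinCircuitSet`). [cite: KumarVolk2022, Lemma 4.1] -/
theorem smallLinCircuitSet_subset_polyMapImage_universalMapInt (K : Type*) [Field K] [CharZero K] :
    smallLinCircuitSet K n s ⊆
      polyMapImage (fun p => map (Int.castRingHom K) (universalMapInt n s p)) := by
  intro x hx
  obtain ⟨β, hβ, hx⟩ := exists_labels_of_mem_smallLinCircuitSet hx
  have : x = fun p : Fin n × Fin n => ucOut β p.1 p.2 := funext fun p => (hx p.1 p.2).symm
  rw [this]
  exact ucOut_mem_polyMapImage_universalMapInt β hβ

/-! ### Soundness of the certificate `Q ∘ Ũ = 0`, `Q(M) ≠ 0` -/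

/-- If `Q ∘ Ũ = 0` identically then `Q` (read in `K`) vanishes on the image of `Ũ` read in `K`.
[cite: KumarVolk2022, §6 (proof of Cor. 1.3)] -/
theorem eval_map_eq_zero_of_mem_polyMapImage {K : Type*} [CommRing K]
    {Q : MvPolynomial (Fin n × Fin n) ℤ} (hQ : bind₁ (universalMapInt n s) Q = 0)
    {x : Fin n × Fin n → K}
    (hx : x ∈ polyMapImage (fun p => map (Int.castRingHom K) (universalMapInt n s p))) :
    eval x (map (Int.castRingHom K) Q) = 0 := by
  obtain ⟨γ, rfl⟩ := hx
  have h := congrArg (fun P => eval γ (map (Int.castRingHom K) P)) hQ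
  simp only [map_bind₁, map_zero] at h
  rw [show eval γ (bind₁ (fun p => map (Int.castRingHom K) (universalMapInt n s p))
      (map (Int.castRingHom K) Q)) = eval (fun p => eval γ (map (Int.castRingHom K)
        (universalMapInt n s p))) (map (Int.castRingHom K) Q) from eval₂Hom_bind₁ _ _ _ _] at h
  exact h

/-- **Soundness of the `FP^{NP}` construction of Cor. 1.3** ("By the properties of the circuit `C`
and the map `U`, `M` does not have linear circuits of size less than …"): if an integer polynomial
`Q` satisfies `Q ∘ Ũ = 0` and `Q(M) ≠ 0` at an integer matrix `M`, then `M`, read in any field of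
characteristic `0`, has no linear circuit of size `≤ s`. [cite: KumarVolk2022, §6 (proof of Cor. 1.3)] -/
theorem not_mem_smallLinCircuitSet_of_eval_ne_zero (K : Type*) [Field K] [CharZero K]
    {Q : MvPolynomial (Fin n × Fin n) ℤ} (hQ : bind₁ (universalMapInt n s) Q = 0)
    {M : Fin n × Fin n → ℤ} (hM : eval M Q ≠ 0) :
    (fun p => (M p : K)) ∉ smallLinCircuitSet K n s := by
  intro hmem
  have h0 := eval_map_eq_zero_of_mem_polyMapImage hQ
    (smallLinCircuitSet_subset_polyMapImage_universalMapInt K hmem)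
  have key : (Int.castRingHom K) (eval M Q) =
      eval (fun p => (M p : K)) (map (Int.castRingHom K) Q) := by
    rw [eval_map]
    show (Int.castRingHom K) (eval₂Hom (RingHom.id ℤ) M Q) = _
    rw [map_eval₂Hom, RingHom.comp_id, coe_eval₂Hom]
    rfl
  rw [← key, eq_intCast] at h0
  exact hM (by exact_mod_cast h0)

/-! ### An integer equation of degree `≤ n³` (Theorem 1.2's count, denominators cleared) -/

/-- Clearing denominators: a nonzero rational polynomial has a nonzero integer multiple of no
larger degree whose image is a constant multiple of it. [folklore] -/
private theorem exists_int_multiple {σ : Type*} (Q : MvPolynomial σ ℚ) :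
    ∃ (Q' : MvPolynomial σ ℤ) (N : ℤ), N ≠ 0 ∧ map (Int.castRingHom ℚ) Q' = C (N : ℚ) * Q := by
  classical
  -- `N = ∏ denominators`, coefficient `m ↦ num_m · ∏_{m' ≠ m} den_{m'}`
  set den : (σ →₀ ℕ) → ℤ := fun m => ((Q.coeff m).den : ℤ) with hden
  set N : ℤ := ∏ m ∈ Q.support, den m with hN
  set z : (σ →₀ ℕ) → ℤ := fun m => (Q.coeff m).num * ∏ m' ∈ Q.support.erase m, den m' with hz
  refine ⟨∑ m ∈ Q.support, monomial m (z m), N, ?_, ?_⟩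
  · rw [hN]
    exact Finset.prod_ne_zero_iff.2 fun m _ => by
      rw [hden]; exact Int.natCast_ne_zero.2 (Q.coeff m).den_nz
  · ext m
    rw [coeff_map, coeff_C_mul, coeff_sum]
    by_cases hm : m ∈ Q.support
    · have hsum : (∑ x ∈ Q.support, coeff m (monomial x (z x))) = z m := by
        rw [Finset.sum_eq_single_of_mem m hm (fun m' _ hne => by rw [coeff_monomial, if_neg hne]),
          coeff_monomial, if_pos rfl]
      rw [hsum, eq_intCast, hN, ← Finset.mul_prod_erase _ _ hm, hz]
      have hq : (Q.coeff m : ℚ) * ((Q.coeff m).den : ℚ) = ((Q.coeff m).num : ℚ) :=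
        Rat.mul_den_eq_num _
      have hd : ((den m : ℤ) : ℚ) = ((Q.coeff m).den : ℚ) := by rw [hden]; push_cast; rfl
      push_cast
      rw [hd, ← hq]
      ring
    · have hsum : (∑ x ∈ Q.support, coeff m (monomial x (z x))) = 0 :=
        Finset.sum_eq_zero fun m' hm' => by
          rw [coeff_monomial, if_neg]
          rintro rfl
          exact hm hm'
      rw [hsum, map_zero, notMem_support_iff.1 hm, mul_zero]

/-- `map` does not raise the total degree (its support can only shrink). [folklore] -/
private theorem totalDegree_map_le' {σ R S : Type*} [CommSemiring R] [CommSemiring S]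
    (f : R →+* S) (q : MvPolynomial σ R) : (map f q).totalDegree ≤ q.totalDegree := by
  classical
  unfold totalDegree
  exact Finset.sup_mono (support_map_subset f q)

/-- Theorem 1.2's dimension count for the integer universal map read in `ℚ`, as a polynomial
identity over `ℚ` (`ℚ` is infinite, so vanishing on the image is `Q ∘ Ũ = 0`).
[cite: KumarVolk2022, Thm. 1.2 (proof, §4.2)] -/
theorem exists_rat_equation_universalMapInt {n s : ℕ} (hn : 1 ≤ n) (hs : 200 * s ≤ n ^ 2) :
    ∃ Q : MvPolynomial (Fin n × Fin n) ℚ, Q ≠ 0 ∧ Q.totalDegree ≤ n ^ 3 ∧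
      bind₁ (fun p => map (Int.castRingHom ℚ) (universalMapInt n s p)) Q = 0 := by
  classical
  have hdegU : ∀ p : Fin n × Fin n, (map (Int.castRingHom ℚ) (universalMapInt n s p)).totalDegree ≤
      (s * n + (s * s + n * (n + s))) * (s + 1) := fun p =>
    (totalDegree_map_le' _ _).trans (totalDegree_universalMapInt_le n s p)
  have hcount : (Fintype.card (Fin s ⊕ Fin s) + (s * n + (s * s + n * (n + s))) * (s + 1) * n ^ 3).choose
      (Fintype.card (Fin s ⊕ Fin s)) <
      (Fintype.card (Fin n × Fin n) + n ^ 3).choose (Fintype.card (Fin n × Fin n)) := by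
    simp only [Fintype.card_sum, Fintype.card_fin, Fintype.card_prod]
    exact thm_1_2_count hn hs
  obtain ⟨Q, hQ, hdeg⟩ := exists_isEquationFor_polyMapImage
    (fun p => map (Int.castRingHom ℚ) (universalMapInt n s p)) hdegU hcount
  refine ⟨Q, hQ.1, hdeg, MvPolynomial.funext fun γ => ?_⟩
  rw [map_zero]
  have h := hQ.2 (fun p => eval γ (map (Int.castRingHom ℚ) (universalMapInt n s p))) ⟨γ, rfl⟩
  refine Eq.trans ?_ h
  exact eval₂Hom_bind₁ _ _ _ _

/-- **Theorem 1.2 for the integer universal map, as a polynomial identity**: for `n ≥ 1` and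
`200 s ≤ n²` there is a nonzero INTEGER polynomial `Q` in the `n²` matrix entries, of degree
`≤ n³`, with `Q ∘ Ũ = 0` identically (the rational equation of
`exists_rat_equation_universalMapInt` with denominators cleared, `exists_int_multiple`).
[cite: KumarVolk2022, Thm. 1.2 (proof, §4.2)] -/
theorem exists_int_equation_universalMapInt {n s : ℕ} (hn : 1 ≤ n) (hs : 200 * s ≤ n ^ 2) :
    ∃ Q : MvPolynomial (Fin n × Fin n) ℤ,
      Q ≠ 0 ∧ Q.totalDegree ≤ n ^ 3 ∧ bind₁ (universalMapInt n s) Q = 0 := by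
  obtain ⟨Q, hQ0, hdeg, hbind⟩ := exists_rat_equation_universalMapInt hn hs
  obtain ⟨Q', N, hN, hQ'⟩ := exists_int_multiple Q
  have hinj : Function.Injective (Int.castRingHom ℚ) := (Int.castRingHom ℚ).injective_int
  refine ⟨Q', ?_, ?_, ?_⟩
  · intro h
    rw [h, map_zero] at hQ'
    exact (mul_ne_zero (C_ne_zero.2 (Int.cast_ne_zero.2 hN)) hQ0) hQ'.symm
  · have h1 : Q'.totalDegree = (map (Int.castRingHom ℚ) Q').totalDegree := by
      unfold totalDegree
      rw [support_map_of_injective _ hinj]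
    rw [h1, hQ']
    calc (C (N : ℚ) * Q).totalDegree
        ≤ (C (N : ℚ) : MvPolynomial (Fin n × Fin n) ℚ).totalDegree + Q.totalDegree :=
          totalDegree_mul _ _
      _ ≤ n ^ 3 := by rw [totalDegree_C, zero_add]; exact hdeg
  · apply map_injective (Int.castRingHom ℚ) hinj
    rw [map_bind₁, hQ', map_zero, map_mul, hbind, mul_zero]

end UniversalMapInt

end KumarVolk2020

end Literature.Computability.AlgebraicComplexity
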